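import Summits.ResolutionOfSingularities.ResolutionOfSingularities.Theorems.HilbertSamuelEliminationSigmaMaxModificationsCorridor3SigmaMenuPlus
import Literature.AlgebraicGeometry.Resolution.BlowupSNC
import HarnessLib

/-!
# [OURS · L1 W4.2] σ-LAYER (E2′/E4d-dyn) — `Corridor3SigmaMenuCorners`: the full-corner locus ALONG A RUN — what propagates and under which clause

Additive sibling of `…Corridor3SigmaMenuDefs` / `…SigmaMenuPlus` (res-type-067 g12; object «E4d-dyn» of res-L1-w42-plan-1 RULING v3.14-13 (DB):
«NEXT OFFER OF RECORD: `tripleMeetsFinite_next`»). OURS (cell res-hironaka, slot W4.2); NOT statements of H. Hironaka's manuscript [Hironaka2017]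
nor of [CossartJannsenSaito2020] / [Kollar2007]; AI-typed, weaker than expert review. Helper VOCABULARY + proved bookkeeping,
`--supports stmt-ResolutionOfSingularities-19249 --as helper` (counted 0); NO row is claimed.

## What is true and what is not (honest scoping of (DB)'s offer)

(DB) proposed `E.TripleMeetsFinite → IsMenuCentrePlusAt E N ν x C → (E.next C).TripleMeetsFinite`. AS STATED this does not hold: blow up a
point `C = {x}` through which two boundary members pass with a COMMON TANGENT PLANE — their strict transforms meet the new exceptional divisor
in the SAME line, a one-dimensional triple intersection; `TripleMeetsFinite` carries no transversality, and the σ-layer's `Boundary W` lives on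
the (singular) stage `W`, where the BGMW/Kollár snc predicate `HasSNCWith` (regular ambient) is not available. What DOES hold, fact-free and in
the σ-layer's own point-set currency, is the propagation MODULO ONE PER-STEP CLAUSE on the new exceptional divisor:

* §1 `Boundary.PairsMeetNewFinite E C` — «the strict transforms of any two members (distinct indices) meet the new exceptional divisor
  `V(C·𝒪_{Bl})` in a finite set» (the transversality content; in the embedded frame it is what «E snc on the regular ambient + centre with normal
  crossings + directrix transversal to the boundary» delivers; scheme-side on `W` it is the clause a menu-disciplined oracle must carry, or a
  dictionary row supplies on the toric scope).
* §2 `injOn_compl_preimage_support` (a blow-up is injective off the preimage of its centre — Stacks 02OS via the tree's `IsBlowup.isIso_compl`),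
  the index bookkeeping of `Boundary.next`, and **`tripleMeetsFinite_next`**:
  `E.TripleMeetsFinite → E.PairsMeetNewFinite C → (E.next C).TripleMeetsFinite` (old triples: off the exceptional divisor `π` is injective into
  the old finite triple intersection, on it the pair clause bites; triples with the new member: the pair clause).
* §4 (rev 2) ALONG A RUN: `StrategyE.RespectsPairClauseOn 𝒮 N ν σ` (the discipline clause), `CanonicalNearStepσE.tripleMeetsFinite`,
  `ReachesσE.tripleMeetsFinite`, **`InScopeMσE.tripleMeetsFinite`** / `InScopeMσE.fullCornerLocus_finite` (E4d for runs from a maximal origin, `E₀ = []`).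
* §3 consequences: `fullCornerLocus_finite_next`, the vacuous base cases (`tripleMeetsFinite_of_length_le_two`, `_nil`) — every maximal origin
  starts with `E₀ = []` — and `pairsMeetNewFinite_of_length_le_one`.
-/

noncomputable section

set_option linter.dupNamespace false

open CategoryTheory AlgebraicGeometry TopologicalSpace
open Summit.ResolutionOfSingularities.ResolutionOfSingularities.Theorems.CampaignW42
open Literature.AlgebraicGeometry.Resolution Literature.RingTheory.HilbertSamuel

namespace Summit.ResolutionOfSingularities.ResolutionOfSingularities.Theorems.SigmaMaxModificationsCorridor3.Sigma

universe u

variable {W : Scheme.{u}}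

/-! ## §1. The per-step transversality clause -/

/-- [OURS · L1 W4.2] **PAIRS OF MEMBERS MEET THE NEW EXCEPTIONAL DIVISOR FINITELY**: for any two boundary members with distinct indices, the
supports of their strict transforms under `Bl_C W → W` meet the exceptional divisor `V(C·𝒪_{Bl_C W})` in a finite set. The honest per-step
clause under which full corners stay finitely many (§2); NOT automatic (tangent members at a point centre violate it). NOT a statement of the
manuscript. [folklore] -/
def Boundary.PairsMeetNewFinite (E : Boundary W) (C : W.IdealSheafData) : Prop :=
  ∀ i j : Fin E.length, i < j →
    (((strictTransformIdeal (blowup.π C) C (E.get i)).support : Set ↥(blowup C)) ∩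
        (strictTransformIdeal (blowup.π C) C (E.get j)).support ∩ (C.comap (blowup.π C)).support).Finite

/-- With at most one boundary member the pair clause is vacuous. [folklore] -/
theorem pairsMeetNewFinite_of_length_le_one {E : Boundary W} (h : E.length ≤ 1) (C : W.IdealSheafData) :
    E.PairsMeetNewFinite C := by
  intro i j hij
  exfalso
  have := Fin.lt_def.mp hij; have := j.2; omega

/-! ## §2. Propagation of `TripleMeetsFinite` along one blow-up -/

/-- **A blow-up is injective off the preimage of its centre** (it is an isomorphism over the complement of the centre, Stacks 02OS =
tree `IsBlowup.isIso_compl`). [cite: StacksProject, Tag 02OS] -/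
theorem injOn_compl_preimage_support (C : W.IdealSheafData) :
    Set.InjOn (blowup.π C).base ((blowup.π C).base ⁻¹' (C.support : Set W))ᶜ := by
  set U : W.Opens := ⟨(C.support : Set W)ᶜ, C.support.isClosed.isOpen_compl⟩ with hU
  haveI : IsIso (blowup.π C ∣_ U) := (blowup.isBlowup C).isIso_compl
  intro a ha b hb hab
  have ha' : a ∈ blowup.π C ⁻¹ᵁ U := ha
  have hb' : b ∈ blowup.π C ⁻¹ᵁ U := hb
  have heq : (blowup.π C ∣_ U).base ⟨a, ha'⟩ = (blowup.π C ∣_ U).base ⟨b, hb'⟩ := by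
    apply Subtype.ext
    rw [morphismRestrict_base_coe, morphismRestrict_base_coe]
    exact hab
  exact congrArg Subtype.val ((blowup.π C ∣_ U).isOpenEmbedding.injective heq)

/-- The support of the new exceptional member is the preimage of the centre's support. [folklore] -/
theorem coe_support_comap_blowup (C : W.IdealSheafData) :
    ((C.comap (blowup.π C)).support : Set ↥(blowup C)) = (blowup.π C).base ⁻¹' (C.support : Set W) := by
  rw [Scheme.IdealSheafData.support_comap]; rfl

/-- Index bookkeeping: an OLD index of `E.next C` carries the strict transform of that member. [folklore] -/
theorem Boundary.get_next_of_lt (E : Boundary W) (C : W.IdealSheafData) (m : Fin (E.next C).length) (hm : m.val < E.length) :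
    (E.next C).get m = strictTransformIdeal (blowup.π C) C (E.get ⟨m.val, hm⟩) := by
  simp only [List.get_eq_getElem, Boundary.next]
  rw [List.getElem_append_left (by simpa using hm), List.getElem_map]

/-- Index bookkeeping: the LAST index of `E.next C` is the new exceptional member. [folklore] -/
theorem Boundary.get_next_of_not_lt (E : Boundary W) (C : W.IdealSheafData) (m : Fin (E.next C).length) (hm : ¬ m.val < E.length) :
    (E.next C).get m = C.comap (blowup.π C) := by
  have hlen : m.val < E.length + 1 := by simpa using m.2
  have hm' : m.val = E.length := by omega
  simp only [List.get_eq_getElem, Boundary.next]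
  rw [List.getElem_append_right (by simpa using hm)]
  simp [hm']

/-- **`TripleMeetsFinite` PROPAGATES along a blow-up MODULO the pair clause.** [folklore] -/
theorem tripleMeetsFinite_next [IsLocallyNoetherian W] {E : Boundary W} (hE : E.TripleMeetsFinite) {C : W.IdealSheafData}
    (hP : E.PairsMeetNewFinite C) : (E.next C).TripleMeetsFinite := by
  intro i j k hij hjk
  have hk : k.val < E.length + 1 := by simpa using k.2
  have hi : i.val < E.length := by have := Fin.lt_def.mp hij; have := Fin.lt_def.mp hjk; omega
  have hj : j.val < E.length := by have := Fin.lt_def.mp hjk; omega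
  rw [E.get_next_of_lt C i hi, E.get_next_of_lt C j hj]
  set π := blowup.π C with hπ
  set Si := ((strictTransformIdeal π C (E.get ⟨i.val, hi⟩)).support : Set ↥(blowup C)) with hSi
  set Sj := ((strictTransformIdeal π C (E.get ⟨j.val, hj⟩)).support : Set ↥(blowup C)) with hSj
  have hPij : (Si ∩ Sj ∩ ((C.comap π).support : Set ↥(blowup C))).Finite :=
    hP ⟨i.val, hi⟩ ⟨j.val, hj⟩ (Fin.lt_def.mpr (Fin.lt_def.mp hij))
  by_cases hkE : k.val < E.length
  · -- three OLD members
    rw [E.get_next_of_lt C k hkE]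
    set Sk := ((strictTransformIdeal π C (E.get ⟨k.val, hkE⟩)).support : Set ↥(blowup C)) with hSk
    have hold : (((E.get ⟨i.val, hi⟩).support : Set W) ∩ (E.get ⟨j.val, hj⟩).support ∩ (E.get ⟨k.val, hkE⟩).support).Finite :=
      hE ⟨i.val, hi⟩ ⟨j.val, hj⟩ ⟨k.val, hkE⟩ (Fin.lt_def.mpr (Fin.lt_def.mp hij)) (Fin.lt_def.mpr (Fin.lt_def.mp hjk))
    -- split along the exceptional divisor
    have hsplit : Si ∩ Sj ∩ Sk ⊆ (Si ∩ Sj ∩ ((C.comap π).support : Set ↥(blowup C))) ∪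
        (Si ∩ Sj ∩ Sk ∩ (π.base ⁻¹' (C.support : Set W))ᶜ) := by
      intro y hy
      by_cases hyF : y ∈ ((C.comap π).support : Set ↥(blowup C))
      · exact Or.inl ⟨hy.1, hyF⟩
      · refine Or.inr ⟨hy, ?_⟩
        rwa [coe_support_comap_blowup] at hyF
    refine ((hPij.union ?_).subset hsplit)
    -- off the exceptional divisor: `π` is injective and lands in the old (finite) triple intersection
    refine Set.Finite.of_finite_image (hold.subset ?_) ((injOn_compl_preimage_support C).mono fun y hy => hy.2)
    rintro _ ⟨y, ⟨⟨⟨hyi, hyj⟩, hyk⟩, -⟩, rfl⟩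
    exact ⟨⟨mem_support_of_mem_support_strictTransformIdeal hyi, mem_support_of_mem_support_strictTransformIdeal hyj⟩,
      mem_support_of_mem_support_strictTransformIdeal hyk⟩
  · -- the third member is the NEW exceptional divisor: the pair clause
    rw [E.get_next_of_not_lt C k hkE]
    exact hPij

/-! ## §3. Consequences for the full-corner locus -/

/-- **Full corners stay finitely many along a blow-up** under the triple binder of the old boundary and the pair clause of the step. [folklore] -/
theorem fullCornerLocus_finite_next [IsLocallyNoetherian W] {E : Boundary W} (hE : E.TripleMeetsFinite) {C : W.IdealSheafData}
    (hP : E.PairsMeetNewFinite C) (N : ℕ) (ν : ℕ → ℕ) : (fullCornerLocus (E.next C) N ν).Finite :=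
  fullCornerLocus_finite (tripleMeetsFinite_next hE hP) N ν

/-- With at most two members the triple binder is vacuous. [folklore] -/
theorem tripleMeetsFinite_of_length_le_two {E : Boundary W} (h : E.length ≤ 2) : E.TripleMeetsFinite := by
  intro i j k hij hjk
  have := Fin.lt_def.mp hij; have := Fin.lt_def.mp hjk; have := k.2; omega

/-- The empty boundary (every maximal origin's start) satisfies the triple binder. [folklore] -/
@[simp] theorem tripleMeetsFinite_nil : Boundary.TripleMeetsFinite ([] : Boundary W) :=
  tripleMeetsFinite_of_length_le_two (by simp)

/-- Hence after the FIRST blow-up of a run the boundary `[].next C = [V(C·𝒪)]` satisfies the binder (one member). [folklore] -/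
theorem tripleMeetsFinite_nil_next (C : W.IdealSheafData) : (Boundary.next ([] : Boundary W) C).TripleMeetsFinite :=
  tripleMeetsFinite_of_length_le_two (by simp)

/-! ## §4 (appended 2026-08-27, same seat, rev 2). ALONG A RUN: a strategy that respects the pair clause keeps the triple binder — E4d closed
for boundary-threaded σ-runs from a maximal origin started with `E₀ = []` (RULING v3.14-16 (EK): «`tripleMeetsFinite_next` + `tripleMeetsFinite_nil`
close E4d for runs from a maximal origin» — here as theorems BY NAME over o1's `CanonicalNearStepσE` / `ReachesσE` / `InScopeMσE`). -/

/-- [OURS · L1 W4.2] **σ RESPECTS THE PAIR CLAUSE ON THE SCOPE `𝒮`**: every step σ allows from a state `(W, L, P, E)` in `𝒮` has a centre `C` with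
`E.PairsMeetNewFinite C`. The discipline clause the corner oracle carries (o1's `CentreMenu` rev); on the toric scope it is automatic (RULING (EK)).
NOT a statement of the manuscript. [folklore] -/
def StrategyE.RespectsPairClauseOn
    (𝒮 : ∀ (W : Scheme.{u}), IsLocallyNoetherian W → Labelling W → Option (Pending W) → Boundary W → Prop)
    (N : ℕ) (ν : ℕ → ℕ) (σ : StrategyE.{u}) : Prop :=
  ∀ (W : Scheme.{u}) (hW : IsLocallyNoetherian W) (L : Labelling W) (P : Option (Pending W)) (E : Boundary W), 𝒮 W hW L P E →
    ∀ (C : W.IdealSheafData) (P' : Option (Pending (blowup C))), σ.step W hW N ν L P E C P' → E.PairsMeetNewFinite C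

/-- The pair clause is monotone in the scope. [folklore] -/
theorem StrategyE.RespectsPairClauseOn.mono
    {𝒮 𝒮' : ∀ (W : Scheme.{u}), IsLocallyNoetherian W → Labelling W → Option (Pending W) → Boundary W → Prop}
    (h𝒮 : ∀ W hW L P E, 𝒮' W hW L P E → 𝒮 W hW L P E) {N : ℕ} {ν : ℕ → ℕ} {σ : StrategyE.{u}}
    (h : σ.RespectsPairClauseOn 𝒮 N ν) : σ.RespectsPairClauseOn 𝒮' N ν :=
  fun W hW L P E hS C P' hstep => h W hW L P E (h𝒮 W hW L P E hS) C P' hstep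

/-- **ONE σ-STEP keeps the triple binder** when σ respects the pair clause at the state stepped from. [folklore] -/
theorem CanonicalNearStepσE.tripleMeetsFinite {σ : StrategyE.{u}} {N : ℕ} {ν : ℕ → ℕ}
    {𝒮 : ∀ (W : Scheme.{u}), IsLocallyNoetherian W → Labelling W → Option (Pending W) → Boundary W → Prop}
    (hσ : σ.RespectsPairClauseOn 𝒮 N ν) {s s' : MarkedStageE.{u}} (h : CanonicalNearStepσE σ N ν s s')
    (hs : 𝒮 s.W s.ln s.L s.P s.E) (hE : s.E.TripleMeetsFinite) : s'.E.TripleMeetsFinite := by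
  obtain ⟨C, P', hln, x', hstep, -, -, -, rfl⟩ := h
  haveI := s.ln
  exact tripleMeetsFinite_next hE (hσ s.W s.ln s.L s.P s.E hs C P' hstep)

/-- **ALONG A RUN**: if σ respects the pair clause on a scope containing every state REACHED from `s₀`, the triple binder of `s₀` propagates to every
reached stage. [folklore] -/
theorem ReachesσE.tripleMeetsFinite {σ : StrategyE.{u}} {N : ℕ} {ν : ℕ → ℕ}
    {𝒮 : ∀ (W : Scheme.{u}), IsLocallyNoetherian W → Labelling W → Option (Pending W) → Boundary W → Prop}
    (hσ : σ.RespectsPairClauseOn 𝒮 N ν) {s₀ s : MarkedStageE.{u}} (h : ReachesσE σ N ν s₀ s)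
    (hscope : ∀ t : MarkedStageE.{u}, ReachesσE σ N ν s₀ t → 𝒮 t.W t.ln t.L t.P t.E)
    (h0 : s₀.E.TripleMeetsFinite) : s.E.TripleMeetsFinite := by
  induction h with
  | refl => exact h0
  | tail hreach hlast ih => exact hlast.tripleMeetsFinite hσ (hscope _ hreach) ih

/-- **E4d FOR RUNS FROM A MAXIMAL ORIGIN (initial boundary `[]`)**: on the reachable-state scope of RULING (CC) (`StrategyE.ReachableState`), a
strategy respecting the pair clause has `TripleMeetsFinite` — hence finitely many full corners — at EVERY stage in scope. [folklore] -/
theorem InScopeMσE.tripleMeetsFinite {p : ℕ} {σ : StrategyE.{u}} {N : ℕ} {ν : ℕ → ℕ}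
    (hσ : σ.RespectsPairClauseOn (StrategyE.ReachableState p σ N ν fun _ _ => []) N ν) {s : MarkedStageE.{u}}
    (h : InScopeMσE p σ N ν (fun _ _ => []) s) : s.E.TripleMeetsFinite := by
  obtain ⟨X, hX, x, horig, hreach⟩ := h
  refine hreach.tripleMeetsFinite hσ (fun t ht => ?_) tripleMeetsFinite_nil
  exact ⟨t.pt, X, hX, x, horig, ht⟩

/-- … so the full-corner locus is finite at every stage in scope. [folklore] -/
theorem InScopeMσE.fullCornerLocus_finite {p : ℕ} {σ : StrategyE.{u}} {N : ℕ} {ν : ℕ → ℕ}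
    (hσ : σ.RespectsPairClauseOn (StrategyE.ReachableState p σ N ν fun _ _ => []) N ν) {s : MarkedStageE.{u}}
    (h : InScopeMσE p σ N ν (fun _ _ => []) s) : (fullCornerLocus s.E N ν).Finite :=
  Sigma.fullCornerLocus_finite (h.tripleMeetsFinite hσ) N ν

end Summit.ResolutionOfSingularities.ResolutionOfSingularities.Theorems.SigmaMaxModificationsCorridor3.Sigma

end
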